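import Mathlib
import HarnessLib.Audit
import Summits.PneNP.PneNP.Theorems.PstarChordReadSwitch

/-!
# Outside variables of a terminal core: restriction to a hyperplane, and free outside bits (ROUND-24, O1 at exact tightness; memo g20 §13)

FRONTIER range-avoidance ladder, rung F-N3, ROUND 24 (cell `pnp-ideate`, prover-2 memo `g20/O1-CHORD-READ-g20.md` §11–§13 (residual R2/R3 and the
induction on outside variables); typed target `PstarCoreBoundTargets.TerminalPeelable` (p646951); restricted-model proof complexity — nothing here
bears on `P` versus `NP`).

The chord-read files kill every reading of two generic chords WITHOUT shared switch partners.  For the shared menus ((σ,z), (z,z′)) the natural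
frame is an INDUCTION ON THE OUTSIDE VARIABLES of the readers (variables in no output of `J₀`): substituting a constant for an outside variable keeps
the readers G-constraints on the same core.  This file supplies the two generic steps.

* `terminal_restrict` — RESTRICTION: if `z` lies outside the core and EVERY deleted output `f ∈ J₀` has an (M0) witness with `x_z = κ`, then the
  readers restricted to `{x_z = κ}` (given as G-constraints `w₁', w₂'` agreeing with `w₁, w₂` there, with no more monomials) are again terminal on
  `J₀`.  So a minimal counterexample has every outside variable DOUBLY PINNED (for each value `κ` some deleted output has all its witnesses at
  `x_z ≠ κ`) — the residue to classify (memo g20 §13).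
* `false_of_free_bit₁` / `false_of_free_bit₂` — an outside variable read LINEARLY by one reader and invisible to the other kills (that reader is
  always satisfiable, so the other fails on `Sol(J₀)`, hence is constant: `false_of_gval₂_const`);
* `false_of_common_bit` — an outside variable moving BOTH readers at EVERY point (e.g. read linearly by both, in no monomial) kills: the sum reader
  misses `b₁ ⊕ b₂` on `Sol(J₀)`, so it is constant by `gSat` — but it equals `b₁ ⊕ b₂` at any (M0) witness.

No Assumption A; no genericity.
-/

set_option linter.dupNamespace false -- `Summit.PneNP.PneNP.…`: summit = sub-problem name (D-0017 single-conjunct layout)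

open Finset Literature.Computability.Complexity
open scoped symmDiff
open Summit.PneNP.PneNP.Theorems.PstarTyped (Typed)
open Summit.PneNP.PneNP.Theorems.PstarSALevel (varSet bdry BoundaryExpanding SimpleOverlap)
open Summit.PneNP.PneNP.Theorems.PstarGapPeeling (eval_update_of_not_mem feasible_of_boundaryExpanding)
open Summit.PneNP.PneNP.Theorems.PstarGapOneAll (gval)
open Summit.PneNP.PneNP.Theorems.PstarGConstraint (gval_update_of_forall_ne)
open Summit.PneNP.PneNP.Theorems.PstarCoreBoundTargets (Terminal)
open Summit.PneNP.PneNP.Theorems.PstarGSat (gSat)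
open Summit.PneNP.PneNP.Theorems.PstarGSystemFreeVar (gval_symmDiff)
open Summit.PneNP.PneNP.Theorems.PstarFreshEraseGates (terminal_symm)
open Summit.PneNP.PneNP.Theorems.PstarChordReads (gval_update_not)
open Summit.PneNP.PneNP.Theorems.PstarChordReadSwitch (solves_update_of_outside xor_gval_of_switch_both)

namespace Summit.PneNP.PneNP.Theorems.PstarChordReadRestrict

variable {n m : ℕ}

section Restrict

variable {I : LocalMap 4 n m} {r : ℕ} {y : Fin m → Bool} {J₀ : Finset (Fin m)} {w₁ w₂ w₁' w₂' : Finset (Fin n) × Finset (Fin m) × Bool}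
  {z : Fin n}

/-- **RESTRICTION TO A HYPERPLANE `{x_z = κ}`.**  `z` outside the core; `w₁', w₂'` are G-constraints with monomials among those of `w₁, w₂` that
agree with `w₁, w₂` at every point with `x_z = κ` (the readers with `z := κ` substituted); if every `f ∈ J₀` has an (M0) witness with `x_z = κ`,
the restricted pair is terminal on `J₀`. -/
theorem terminal_restrict (ht : Terminal I r y J₀ w₁ w₂) (hz : ∀ j ∈ J₀, z ∉ varSet I j) (κ : Bool)
    (hG₁ : w₁'.2.1 ⊆ w₁.2.1) (hG₂ : w₂'.2.1 ⊆ w₂.2.1)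
    (h₁ : ∀ x : Fin n → Bool, x z = κ → (gval I w₁'.1 w₁'.2.1 x = w₁'.2.2 ↔ gval I w₁.1 w₁.2.1 x = w₁.2.2))
    (h₂ : ∀ x : Fin n → Bool, x z = κ → (gval I w₂'.1 w₂'.2.1 x = w₂'.2.2 ↔ gval I w₂.1 w₂.2.1 x = w₂.2.2))
    (hz₁ : z ∉ w₁'.1) (hz₂ : z ∉ w₂'.1) (hzG₁ : ∀ g ∈ w₁'.2.1, I.vars g 2 ≠ z ∧ I.vars g 3 ≠ z)
    (hzG₂ : ∀ g ∈ w₂'.2.1, I.vars g 2 ≠ z ∧ I.vars g 3 ≠ z)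
    (hM0 : ∀ f ∈ J₀, ∃ x : Fin n → Bool, (∀ j ∈ J₀.erase f, I.eval x j = y j) ∧ x z = κ ∧
      gval I w₁.1 w₁.2.1 x = w₁.2.2 ∧ gval I w₂.1 w₂.2.1 x = w₂.2.2) :
    Terminal I r y J₀ w₁' w₂' := by
  classical
  obtain ⟨hne, hX, hJr, hd₁, hd₂, hr, hT3, -⟩ := ht
  refine ⟨hne, hX, hJr, hd₁.mono_right hG₁, hd₂.mono_right hG₂, ?_, ?_, ?_⟩
  · exact (card_le_card (union_subset_union (union_subset_union (Subset.refl _) hG₁) hG₂)).trans hr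
  · -- (T3): move a joint solution of the restricted pair onto the hyperplane (the restricted readers do not see `z`)
    rintro ⟨x, hx, hx₁, hx₂⟩
    have hx' := solves_update_of_outside hz hx κ
    have hzκ : Function.update x z κ z = κ := Function.update_self ..
    refine hT3 ⟨_, hx', (h₁ _ hzκ).1 ?_, (h₂ _ hzκ).1 ?_⟩
    · rw [gval_update_of_forall_ne I x hz₁ hzG₁]; exact hx₁
    · rw [gval_update_of_forall_ne I x hz₂ hzG₂]; exact hx₂
  · intro f hf
    obtain ⟨x, hx, hxz, hx₁, hx₂⟩ := hM0 f hf
    exact ⟨x, hx, (h₁ x hxz).2 hx₁, (h₂ x hxz).2 hx₂⟩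

end Restrict

section FreeBits

variable {I : LocalMap 4 n m} {r : ℕ} {y : Fin m → Bool} {J₀ : Finset (Fin m)} {w₁ w₂ : Finset (Fin n) × Finset (Fin m) × Bool} {z : Fin n}

/-- **FREE BIT of `Γ₁`.**  An outside variable read linearly by `Γ₁`, in no monomial of `Γ₁`, and invisible to `Γ₂` kills the terminal core:
flipping it always satisfies `Γ₁`, so (T3) makes `Γ₂` miss `b₂` on all of `Sol(J₀)`, and `gSat` makes `Γ₂` constant. -/
theorem false_of_free_bit₁ (hI : I.IsPure xorAndPred) (hT : Typed I) (hS : SimpleOverlap I) (hB : BoundaryExpanding r I)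
    (ht : Terminal I r y J₀ w₁ w₂) (hz : ∀ j ∈ J₀, z ∉ varSet I j) (hz₁ : z ∈ w₁.1) (hzG₁ : ∀ g ∈ w₁.2.1, I.vars g 2 ≠ z ∧ I.vars g 3 ≠ z)
    (hz₂ : z ∉ w₂.1) (hzG₂ : ∀ g ∈ w₂.2.1, I.vars g 2 ≠ z ∧ I.vars g 3 ≠ z) : False := by
  classical
  have hmiss : ∀ x : Fin n → Bool, (∀ j ∈ J₀, I.eval x j = y j) → gval I w₂.1 w₂.2.1 x ≠ w₂.2.2 := by
    intro x hx h₂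
    have hx' := solves_update_of_outside hz hx (!x z)
    have hflip := gval_update_not I w₁.1 x (G := w₁.2.1) hzG₁
    rw [if_pos hz₁] at hflip
    have h₂' : gval I w₂.1 w₂.2.1 (Function.update x z (!x z)) = w₂.2.2 := by rw [gval_update_of_forall_ne I x hz₂ hzG₂]; exact h₂
    by_cases h₁ : gval I w₁.1 w₁.2.1 x = w₁.2.2
    · exact ht.2.2.2.2.2.2.1 ⟨x, hx, h₁, h₂⟩
    · refine ht.2.2.2.2.2.2.1 ⟨_, hx', ?_, h₂'⟩
      rw [hflip]; revert h₁; cases gval I w₁.1 w₁.2.1 x <;> cases w₁.2.2 <;> decide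
  obtain ⟨hne, -, hJr, -, hdj₂, -, -, hM0⟩ := ht
  obtain ⟨f, hf⟩ := hne
  obtain ⟨u, -, -, hu₂⟩ := hM0 f hf
  by_cases hnc : ∃ a a' : Fin n → Bool, gval I w₂.1 w₂.2.1 a ≠ gval I w₂.1 w₂.2.1 a'
  · obtain ⟨x, hx, hx₂⟩ := gSat n m r I hI hT hB hS y J₀ w₂.2.1 w₂.1 w₂.2.2 hJr.le hdj₂ hnc
    exact hmiss x hx hx₂
  · push Not at hnc
    obtain ⟨x, hx⟩ := feasible_of_boundaryExpanding I hI hB y J₀ hJr.le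
    exact hmiss x hx (by rw [hnc x u]; exact hu₂)

/-- **FREE BIT of `Γ₂`** (mirror image). -/
theorem false_of_free_bit₂ (hI : I.IsPure xorAndPred) (hT : Typed I) (hS : SimpleOverlap I) (hB : BoundaryExpanding r I)
    (ht : Terminal I r y J₀ w₁ w₂) (hz : ∀ j ∈ J₀, z ∉ varSet I j) (hz₂ : z ∈ w₂.1) (hzG₂ : ∀ g ∈ w₂.2.1, I.vars g 2 ≠ z ∧ I.vars g 3 ≠ z)
    (hz₁ : z ∉ w₁.1) (hzG₁ : ∀ g ∈ w₁.2.1, I.vars g 2 ≠ z ∧ I.vars g 3 ≠ z) : False :=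
  false_of_free_bit₁ hI hT hS hB (terminal_symm ht) hz hz₂ hzG₂ hz₁ hzG₁

/-- **COMMON BIT.**  An outside variable that moves BOTH readers at every point (given semantically) kills: `Γ₁ ⊕ Γ₂ = b₁ ⊕ b₂ ⊕ 1` on `Sol(J₀)`
(`xor_gval_of_switch_both`), so the sum reader is constant by `gSat` (and `J₀` is feasible), against its value `b₁ ⊕ b₂` at an (M0) witness. -/
theorem false_of_common_bit (hI : I.IsPure xorAndPred) (hT : Typed I) (hS : SimpleOverlap I) (hB : BoundaryExpanding r I)
    (ht : Terminal I r y J₀ w₁ w₂) (hz : ∀ j ∈ J₀, z ∉ varSet I j)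
    (hmove₁ : ∀ x : Fin n → Bool, gval I w₁.1 w₁.2.1 (Function.update x z (!x z)) ≠ gval I w₁.1 w₁.2.1 x)
    (hmove₂ : ∀ x : Fin n → Bool, gval I w₂.1 w₂.2.1 (Function.update x z (!x z)) ≠ gval I w₂.1 w₂.2.1 x) : False := by
  classical
  -- the sum reader misses `b₁ ⊕ b₂` on `Sol(J₀)`
  have hmiss : ∀ x : Fin n → Bool, (∀ j ∈ J₀, I.eval x j = y j) →
      gval I (w₁.1 ∆ w₂.1) (w₁.2.1 ∆ w₂.2.1) x ≠ xor w₁.2.2 w₂.2.2 := by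
    intro x hx h
    have hb := xor_gval_of_switch_both ht hz hx (hmove₁ x) (hmove₂ x)
    rw [gval_symmDiff] at h
    rw [h] at hb
    revert hb; cases w₁.2.2 <;> cases w₂.2.2 <;> decide
  -- hence it is constant
  have hconst : ∀ a a' : Fin n → Bool, gval I (w₁.1 ∆ w₂.1) (w₁.2.1 ∆ w₂.2.1) a = gval I (w₁.1 ∆ w₂.1) (w₁.2.1 ∆ w₂.2.1) a' := by
    by_contra hnc
    push Not at hnc
    obtain ⟨a, a', haa⟩ := hnc
    have hdj : Disjoint J₀ (w₁.2.1 ∆ w₂.2.1) := by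
      refine disjoint_left.2 fun g hg hg' => ?_
      rcases Finset.mem_symmDiff.1 hg' with ⟨h, -⟩ | ⟨h, -⟩
      · exact disjoint_left.1 ht.2.2.2.1 hg h
      · exact disjoint_left.1 ht.2.2.2.2.1 hg h
    obtain ⟨x, hx, hxv⟩ := gSat n m r I hI hT hB hS y J₀ (w₁.2.1 ∆ w₂.2.1) (w₁.1 ∆ w₂.1) (xor w₁.2.2 w₂.2.2) ht.2.2.1.le hdj
      ⟨a, a', haa⟩
    exact hmiss x hx hxv
  -- `Γ₂ = Γ₁ ⊕ κ` everywhere, with `κ` read off the (M0) witness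
  obtain ⟨f, hf⟩ := ht.1
  obtain ⟨u, -, hu₁, hu₂⟩ := ht.2.2.2.2.2.2.2 f hf
  obtain ⟨x, hx⟩ := feasible_of_boundaryExpanding I hI hB y J₀ ht.2.2.1.le
  have h := hconst x u
  rw [gval_symmDiff, gval_symmDiff, hu₁, hu₂] at h
  exact hmiss x hx (by rw [gval_symmDiff, h])

end FreeBits

end Summit.PneNP.PneNP.Theorems.PstarChordReadRestrict
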